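/-
  hub-lb-chord-idea-4 g0 — CRUX-IDEATE on stmt-Ventures-21721 `LowerEdge_ge_m4o5` (+ stmt-Ventures-22024).
  Sketch for the crux idea «lag-sum fibre / certificate conversion (REFIT-0)».
  Content: the certificate produced by a Gram dual block depends on the block only through its
  MOMENT-MULTIPLIER PROFILE (sum of coefficient·dual over all entries carrying the same canonical
  moment; on a translation-invariant frame block = the lag sums). Hence (i) fibre invariance,
  (ii) a cover converts a certificate with loss ≤ the ℓ¹ defect of the profiles (|moment| ≤ 1),
  (iii) the lag-sum specialisation. Elementary finite sums; no sorry. No summit statement is proved.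
-/
import Mathlib

open Finset BigOperators

namespace Summit.Ventures.CertifiedManyBodySolver.Cruxes.LowerEdge_ge_m4o5.ChordIdea4Refit

variable {E ι : Type*} [Fintype E] [Fintype ι] [DecidableEq ι]

/-- Moment-multiplier profile of a dual vector `z` on the entries `E` of a Gram block:
`carries e` is the canonical moment carried by entry `e` with coefficient `coef e`
(after translation / point-group / adjoint canonicalisation), and the profile at a moment `t`
is the total multiplier the block puts on `t`. -/
def profile (carries : E → ι) (coef : E → ℝ) (z : E → ℝ) (t : ι) : ℝ :=
  ∑ e ∈ univ with carries e = t, coef e * z e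

/-- What the block contributes to the certificate identity when the moments take values `m`. -/
def pairing (carries : E → ι) (coef : E → ℝ) (z : E → ℝ) (m : ι → ℝ) : ℝ :=
  ∑ e, coef e * z e * m (carries e)

/-- The contribution depends on `z` only through its profile. -/
theorem pairing_eq_sum_profile (carries : E → ι) (coef : E → ℝ) (z : E → ℝ) (m : ι → ℝ) :
    pairing carries coef z m = ∑ t, profile carries coef z t * m t := by
  unfold pairing profile
  rw [← Finset.sum_fiberwise univ carries (fun e => coef e * z e * m (carries e))]
  refine Finset.sum_congr rfl (fun t _ => ?_)
  rw [Finset.sum_mul]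
  refine Finset.sum_congr rfl (fun e he => ?_)
  rw [(Finset.mem_filter.1 he).2]

/-- FIBRE INVARIANCE: two duals with the same profile give the same certificate term,
whatever the (unknown) moment values are. -/
theorem pairing_eq_of_profile_eq (carries : E → ι) (coef : E → ℝ) {z z' : E → ℝ}
    (h : profile carries coef z = profile carries coef z') (m : ι → ℝ) :
    pairing carries coef z m = pairing carries coef z' m := by
  rw [pairing_eq_sum_profile, pairing_eq_sum_profile, h]

/-- ℓ¹ defect between the profiles of two duals. -/
def defect (carries : E → ι) (coef : E → ℝ) (z z' : E → ℝ) : ℝ :=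
  ∑ t, |profile carries coef z t - profile carries coef z' t|

/-- CONVERSION FLOOR: if every canonical moment is bounded by 1 in absolute value (normalised
ladder words), replacing `z` by any `z'` (e.g. one supported on a clique cover) costs at most the
ℓ¹ defect of the profiles — the defect is absorbed by the certificate's ℓ¹ residual slot. -/
theorem pairing_ge_sub_defect (carries : E → ι) (coef : E → ℝ) (z z' : E → ℝ) (m : ι → ℝ)
    (hm : ∀ t, |m t| ≤ 1) :
    pairing carries coef z m - defect carries coef z z' ≤ pairing carries coef z' m := by
  have key : pairing carries coef z m - pairing carries coef z' m ≤ defect carries coef z z' := by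
    rw [pairing_eq_sum_profile, pairing_eq_sum_profile, ← Finset.sum_sub_distrib]
    unfold defect
    calc ∑ t, (profile carries coef z t * m t - profile carries coef z' t * m t)
        = ∑ t, (profile carries coef z t - profile carries coef z' t) * m t := by
          refine Finset.sum_congr rfl (fun t _ => by ring)
      _ ≤ |∑ t, (profile carries coef z t - profile carries coef z' t) * m t| := le_abs_self _
      _ ≤ ∑ t, |(profile carries coef z t - profile carries coef z' t) * m t| :=
          Finset.abs_sum_le_sum_abs _ _
      _ ≤ ∑ t, |profile carries coef z t - profile carries coef z' t| := by
          refine Finset.sum_le_sum (fun t _ => ?_)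
          rw [abs_mul]
          calc |profile carries coef z t - profile carries coef z' t| * |m t|
              ≤ |profile carries coef z t - profile carries coef z' t| * 1 :=
                mul_le_mul_of_nonneg_left (hm t) (abs_nonneg _)
            _ = _ := mul_one _
  linarith

/-- Zero defect = lossless conversion (the fibre of `z` meets the cover's cone at `z'`). -/
theorem pairing_eq_of_defect_eq_zero (carries : E → ι) (coef : E → ℝ) (z z' : E → ℝ)
    (h0 : defect carries coef z z' = 0) (m : ι → ℝ) :
    pairing carries coef z m = pairing carries coef z' m := by
  apply pairing_eq_of_profile_eq
  funext t
  have hle : ∀ s ∈ (univ : Finset ι), 0 ≤ |profile carries coef z s - profile carries coef z' s| :=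
    fun s _ => abs_nonneg _
  have := (Finset.sum_eq_zero_iff_of_nonneg hle).1 h0 t (mem_univ t)
  have : profile carries coef z t - profile carries coef z' t = 0 := abs_eq_zero.1 this
  linarith

/-! ### Matrix layer: a cover's cone and the conversion predicate -/

/-- Entries of an `n × n` Gram block as a dual vector. -/
def ofMatrix {n : Type*} (Z : Matrix n n ℝ) : n × n → ℝ := fun p => Z p.1 p.2

/-- The dual cone of a clique cover `𝒞` (a family of column subsets): sums of PSD matrices each
supported on one clique (Agler side; here only as the search space of the refit). -/
def coverCone {n : Type*} [Fintype n] [DecidableEq n] (𝒞 : Finset (Finset n)) :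
    Set (Matrix n n ℝ) :=
  {Z | ∃ W : Finset n → Matrix n n ℝ,
      (∀ C ∈ 𝒞, (W C).PosSemidef ∧ ∀ i j, (i ∉ C ∨ j ∉ C) → W C i j = 0) ∧
      Z = ∑ C ∈ 𝒞, W C}

/-- REFIT-0 verdict for one block: the record dual `Z` converts to the cover `𝒞` within `δ`
iff some point of the cover cone has profile within ℓ¹ distance `δ` of `Z`'s profile.
`δ = 0` ⇔ the fibre of `Z` meets the cover cone (lossless at the certificate of record). -/
def ConvertsWithin {n : Type*} [Fintype n] [DecidableEq n]
    (carries : n × n → ι) (coef : n × n → ℝ) (𝒞 : Finset (Finset n))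
    (Z : Matrix n n ℝ) (δ : ℝ) : Prop :=
  ∃ Z' ∈ coverCone 𝒞, defect carries coef (ofMatrix Z) (ofMatrix Z') ≤ δ

/-- Monotone in the tolerance (bookkeeping). -/
theorem ConvertsWithin.mono {n : Type*} [Fintype n] [DecidableEq n]
    {carries : n × n → ι} {coef : n × n → ℝ} {𝒞 : Finset (Finset n)} {Z : Matrix n n ℝ}
    {δ δ' : ℝ} (h : ConvertsWithin carries coef 𝒞 Z δ) (hδ : δ ≤ δ') :
    ConvertsWithin carries coef 𝒞 Z δ' := by
  obtain ⟨Z', hZ', hd⟩ := h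
  exact ⟨Z', hZ', hd.trans hδ⟩

/-! ### Translation-invariant frame blocks: the profile is the LAG SUM -/

section lag
variable {S A G : Type*} [Fintype S] [DecidableEq S] [Fintype A] [AddCommGroup G] [DecidableEq G]

/-- Entry ((s,a),(s',a')) of a frame block (shape × anchor) carries the moment class
(s, s', pos a' − pos a): translation invariance identifies all placements with the same lag. -/
def lagCarrier (pos : A → G) : (S × A) × (S × A) → S × S × G :=
  fun p => (p.1.1, p.2.1, pos p.2.2 - pos p.1.2)

/-- Lag sums ζ_{s,s'}(k) = Σ_{pos a' − pos a = k} Z[(s,a),(s',a')] — the coefficients of the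
PSD-valued trigonometric polynomial E(θ)* Z E(θ); `lagSet` restricts to the finitely many
lags that occur (a Fintype index for the profile). -/
def lagSum (pos : A → G) (Z : Matrix (S × A) (S × A) ℝ) (s s' : S) (k : G) : ℝ :=
  ∑ p ∈ (univ : Finset ((S × A) × (S × A))) with
      (p.1.1 = s ∧ p.2.1 = s' ∧ pos p.2.2 - pos p.1.2 = k), Z p.1 p.2

omit [DecidableEq S] in
/-- For a TI moment functional `m (s,s',k)` the block's certificate term is Σ ζ·m over lags:
two duals with equal lag sums are the same certificate (instance of `pairing_eq_of_profile_eq`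
with `carries = lagCarrier pos`, `coef = 1`, once the lag set is made a Fintype). -/
theorem pairing_lag_eq_of_profile_eq {L : Type*} [Fintype L] [DecidableEq L]
    (carries : (S × A) × (S × A) → L) {Z Z' : Matrix (S × A) (S × A) ℝ}
    (h : profile carries (fun _ => (1 : ℝ)) (ofMatrix Z) = profile carries (fun _ => 1) (ofMatrix Z'))
    (m : L → ℝ) :
    pairing carries (fun _ => (1 : ℝ)) (ofMatrix Z) m = pairing carries (fun _ => 1) (ofMatrix Z') m :=
  pairing_eq_of_profile_eq carries _ h m

end lag

end Summit.Ventures.CertifiedManyBodySolver.Cruxes.LowerEdge_ge_m4o5.ChordIdea4Refit
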